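import Summits.BirchSwinnertonDyer.Rank1Residual.AdditivePotMult.RamifiedOrdinaryLinePotMult
import Summits.BirchSwinnertonDyer.Rank1Residual.AdditivePotMult.TwistTransportLocalSign
import Summits.BirchSwinnertonDyer.Rank1Residual.Additive.LocalTowerKernelAtPOfStableSubgroup
import Summits.BirchSwinnertonDyer.Rank1Residual.Additive.CyclotomicInertiaSqrtPStar
import Summits.BirchSwinnertonDyer.Rank1Residual.Additive.UnramifiedBaseChange
import Summits.BirchSwinnertonDyer.Rank1Residual.Additive.GordRamifiedOrdinaryLineHigher
import Summits.BirchSwinnertonDyer.Rank1Residual.Iwasawa.TateParametrisationUnits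
import HarnessLib

/-!
# T-T3M END: the `v = p` local tower kernel at level `0` VANISHES for `E/ℚ` ADDITIVE POTENTIALLY
# MULTIPLICATIVE at every odd `p` — `W.localTowerKerPrimary κ ℚ_v 0 = ⊥` on X4(M) / X3♯(M), modulo the
# PUBLISHED Tate uniformisation (team n1011, row T-T3M, seat p12 GEN 9; file F4-M = the (M) sibling
# of row T-T3B's `ClassX4Gord.localTowerKerPrimary_zero_eq_bot`)

HONEST FRAMING (cell `b2b-bsdres`, run/shared/lean/b2b/bsd-rank1-residual/, verbatim in every
file): the goal of the cell is to DELETE the COMBINATION-SHAPED residual classes of the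
Birch–Swinnerton-Dyer formula for ALL analytic-rank `≤ 1` elliptic curves over `ℚ` — "full BSD
formula for every rank `≤ 1` curve in class `C`" assembled STRICTLY from published theorems — so
that the rank-`≤ 1` remainder becomes exactly the CONSTRUCTION-SHAPED classes, which are TYPED
(missing-input `Prop`s), NOT attempted. This is not "finishing BSD". Team n1011 (N10/N11; row
T-T3M, skeleton `cells/n1011/skel/T-T3M.md`): research routes on CONSTRUCTION-SHAPED classes
(ROUTE 2 / Route G partners: the `hp0` binder of p06's T-T3CTL ENDs on a PARTNER that is (M) at
`p`); prove what is provable now; no claim beyond stated classes; census output = EVIDENCE, never a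
Literature fact; RESIDUAL-MAP marks UNCHANGED; nothing is booked by this file. Theorems only; NO
definition; NO new named fact. The ONLY named fact is the registered PUBLISHED A41
`Silverman1994_thmV53_corV54_tateUniformisation` (Silverman *ATAEC* V.3.1 / V.5.2–5.4; hypothesis
`hT41`, exactly as in every X2 Tate file and in TB-ROL B-M); X4(M)/X3♯(M) stay CONSTRUCTION-SHAPED.

## What

STATEMENT IN PRINT: Delbourgo, *Iwasawa theory for elliptic curves at unstable primes*,
Compositio Math. 113 (1998), §2.2 Lemma (ii) (p. 139): "Assume `E` satisfies (M) and does not have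
split multiplicative reduction over `ℚ_p`. Then `#H¹(ℚ_{∞,p}/ℚ_p, E(ℚ_{∞,p}))(p) = 1`" — proved there
by Jones's `±`-decomposition, Tate local duality and universal norms ([CoG] p. 172). HERE, for `E`
ADDITIVE potentially multiplicative at the odd prime `p` (`PotMult W p`: `add(p) ∧ ord_p j < 0`),
by a different road, Greenberg's Lemma 3.4 dévissage (row T-T3B) through the UNITS of the twisted
Tate parametrisation:

* `TateTowerKernel.localTowerKerPrimary_zero_eq_bot_of_mult_twist (hT41) (hp2) (hV : Mult V p) (C)
  (hpv) (hadd) (κ)` — for the `p*`-twist model `C • V^{(p*)}` of a globally minimal `V` multiplicative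
  at `p` (`AdditivePotMult/PStarTwistModel`): A41 gives `Ψ_V : K̄_vˣ → V(K̄_v)` (kernel `q^ℤ`,
  `σ • Ψ_V(u) = ±Ψ_V(σu)`, `+` on the inertia group: X2 `inertia_fix_sqrt_gamma`); F3-M's transport
  `T : V(K̄_v) ≃+ (C • V^{(p*)})(K̄_v)` twists by the sign `σ√p*/√p*`; `Ψ := T ∘ Ψ_V`; the inertia
  element `τ` of the `ℤ_p`-tower flipping `√p*` (p12 GEN 4
  `exists_mem_absInertia_kappa_eq_one_smul_geomSqrt_pStar_eq_neg`) has `τ • Ψ(u) = −Ψ(τu)`; F1-M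
  (`Iwasawa/TateParametrisationUnits`) supplies the units image `A₁ = Ψ(𝒪̄ˣ)` with all the
  hypotheses of F2-M's model-free END
  `StableSubgroupLine.localTowerKerPrimary_zero_eq_bot_of_stableSubgroup`.
* `PotMult.localTowerKerPrimary_zero_eq_bot (hT41) (hpm) (hp2) (hpv) (κ)`,
  `ClassX4M.localTowerKerPrimary_zero_eq_bot (hT41) (hX) (hpv) (κ)`,
  `ClassX3M.localTowerKerPrimary_zero_eq_bot (hT41) (hX) (hpv) (κ)` — EVERY odd `p` (`p = 3`
  included), ANY `ℤ_p`-extension `κ` of `ℚ`: the binder `hp0` of p06's T-T3CTL ENDs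
  (`Iwasawa/SelmerInftyTrivialOfLevelZero`, `…LocalTowerKernelAdditive`) on every (M)-at-`p` partner.

NOT claimed: non-split MULTIPLICATIVE `W` at `p` (covered by Delbourgo's (ii); F2-M's `hu`/`hTfin`
road uses p07's ADDITIVE engine); split multiplicative (false: the `𝓛`-invariant kernel, Greenberg
LNM 1716 p. 93); levels `n ≥ 1`.

References: [Delbourgo1998] D. Delbourgo, Compositio Math. 113 (1998) 123–153, §2.2 Lemma (p. 139);
[GreenbergLNM1716] R. Greenberg, LNM 1716 (1999), §3 Lemma 3.4 (p. 89), pp. 92–93, Prop. 3.8;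
[SilvermanATAEC1994] J. H. Silverman, *ATAEC*, V.3.1, V.5.2–5.4; [GreenbergVatsal2000] §2
pp. 14–15; cells/n1011/skel/T-T3M.md; row T-T3B (p12 GEN 8), TB-ROL B-M (p07), X2 Tate files
(eisenstein-p2), TwistTransportLocal (additive-p1), FixedLevel F4 (p07 GEN 9).
-/

noncomputable section

open scoped Classical NumberField

universe u

namespace Summit.BirchSwinnertonDyer.Rank1Residual.AdditivePotMult

open NumberField IsDedekindDomain Field IsDedekindDomain.HeightOneSpectrum WeierstrassCurve
  Literature.NumberTheory.EllipticCurves Literature.NumberTheory.GaloisRepresentations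
  Literature.NumberTheory.EllipticCurves.Rank1Residual
  Summit.BirchSwinnertonDyer.Rank1Residual.X2
  Summit.BirchSwinnertonDyer.Rank1Residual.Iwasawa
  Summit.BirchSwinnertonDyer.Rank1Residual.Additive

namespace TateTowerKernel

variable {p : ℕ} [hp : Fact p.Prime] {v : HeightOneSpectrum (𝓞 ℚ)}

set_option maxHeartbeats 800000 in
/-- **T-T3M END — `𝒦_{v,0}[p^∞] = 0` for the `p*`-twist `C • V^{(p*)}` of a multiplicative `V`**
(`p` odd, `V` globally minimal with `Mult V p`, `C` a rational change of variables, the twist ADDITIVE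
at `v ∋ p`, ANY `ℤ_p`-extension `κ`), modulo the PUBLISHED Tate uniformisation A41 (`hT41`):
`(C • V^{(p*)}).localTowerKerPrimary κ (v.adicCompletion ℚ) 0 = ⊥`. Proof: A41 on `V` at `v`
(`Ψ_V`, kernel `q^ℤ`, sign `+1` on inertia by X2's `inertia_fix_sqrt_gamma`); F3-M's local twist
transport `T` with its sign law; `Ψ = T ∘ Ψ_V` is equivariant up to the PRODUCT sign `χ_{p*}·ε`
(`χ_{p*}(σ) = σ√p*/√p*` RAMIFIED, `ε(σ) = σ√γ_V/√γ_V` the unramified split/non-split sign of A41,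
`= 1` on inertia) — this product is the sign fed to F1-M's (U1)/(U5) and is the character of
`E(K̄_v)/A₁ ⊇ (ℚ_p/ℤ_p)(χ_{p*}ε)` and of `A₁[p] ≅ μ_p ⊗ χ_{p*}ε ≇ μ_p` in F2-M's (S2)/(S4); p12 GEN 4's
inertia element `τ` of the tower with `κ(res τ) = 1` flips `√p*` (moved to `K̄_v` by
`absGaloisRestrict_apply_smul`), so `τ • Ψ(u) = −Ψ(τu)`; F1-M's units image `A₁ = Ψ(𝒪̄ˣ)` is
stable, `p`-divisible, with torsion quotient, `A₁[p] = ⟨Ψ ζ_p⟩`, and `τ` moves `Ψ(q^{1/p})` off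
`A₁`; F2-M's model-free END concludes. Statement in print: Delbourgo 1998 §2.2 Lemma (ii).
[cite: Delbourgo1998, §2.2 Lemma (ii) (p. 139)] [cite: GreenbergLNM1716, §3 Lemma 3.4 (p. 89) and Prop. 3.8 (p. 95)]
[cite: SilvermanATAEC1994, Ch. V Lemma 5.2 (c), Thm. 5.3, Cor. 5.4] -/
theorem localTowerKerPrimary_zero_eq_bot_of_mult_twist
    (hT41 : Silverman1994_thmV53_corV54_tateUniformisation.{0}) (hp2 : p ≠ 2)
    (V : WeierstrassCurve ℚ) [V.IsElliptic] [V.IsGloballyMinimal] (hV : Mult V p)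
    (C : VariableChange ℚ) [(C • V.quadraticTwist ((-1 : ℚ) ^ (p / 2) * p)).IsElliptic]
    (hpv : ((p : ℕ) : 𝓞 ℚ) ∈ v.asIdeal)
    (hadd : (C • V.quadraticTwist ((-1 : ℚ) ^ (p / 2) * p)).HasAdditiveReductionAt v)
    (κ : ZpExtension ℚ p) :
    (C • V.quadraticTwist ((-1 : ℚ) ^ (p / 2) * p)).localTowerKerPrimary κ
      (v.adicCompletion ℚ) 0 = ⊥ := by
  -- (1) the Tate parametrisation of `V` at `v` (A41) and its sign on inertia
  obtain ⟨q, t, ΨV, hq0, hq1, -, ht2, hsurjV, hkerV, hΨσ, -⟩ := hT41 V v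
    (GreenbergVatsalStrictSelmerMultiplicative.hasMultiplicativeReductionAt_of_mem V p hV hpv)
  have hsignV := GreenbergVatsalTateDatumSign.sign_disj V ΨV t hΨσ
  have hinert : ∀ σ ∈ absInertia (v.adicCompletion ℚ),
      Field.absoluteGaloisGroup.toAlgEquiv (v.adicCompletion ℚ) σ t = t := fun σ hσ ↦
    GreenbergVatsalTateDatumRat.inertia_fix_sqrt_gamma V hp2 hV hpv t ht2 σ hσ
  -- (2) the inertia element of the tower flipping `θ = √p* ∈ K̄_v`
  obtain ⟨τ, hτI, hκτ, hflip⟩ :=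
    exists_mem_absInertia_kappa_eq_one_smul_geomSqrt_pStar_eq_neg p κ hp2 hpv
  set θ : AlgebraicClosure (v.adicCompletion ℚ) :=
    absClosureEmbedding ℚ (v.adicCompletion ℚ) (geomSqrt ((-1 : ℚ) ^ (p / 2) * p)) with hθdef
  have hθc : θ ^ 2 = algebraMap ℚ (AlgebraicClosure (v.adicCompletion ℚ)) ((-1 : ℚ) ^ (p / 2) * p) := by
    rw [hθdef, ← map_pow, geomSqrt_sq, AlgHom.commutes]
  have hτθ : τ • θ = -θ := by
    rw [hθdef, ← absGaloisRestrict_apply_smul, hflip, map_neg]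
  have hps0 : ((-1 : ℚ) ^ (p / 2) * p) ≠ 0 :=
    mul_ne_zero (pow_ne_zero _ (by norm_num)) (Nat.cast_ne_zero.mpr hp.out.ne_zero)
  have hθ : θ ∉ Set.range (algebraMap ℚ (AlgebraicClosure (v.adicCompletion ℚ))) := by
    rintro ⟨r, hr⟩
    have hfix : τ • θ = θ := by
      rw [← hr, Field.absoluteGaloisGroup.smul_def]
      exact AlgEquiv.commutes
        ((AlgEquiv.restrictScalars ℚ
          (show AlgebraicClosure (v.adicCompletion ℚ) ≃ₐ[v.adicCompletion ℚ]
              AlgebraicClosure (v.adicCompletion ℚ) from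
            Field.absoluteGaloisGroup.toAlgEquiv (v.adicCompletion ℚ) τ) :
          AlgebraicClosure (v.adicCompletion ℚ) ≃ₐ[ℚ] AlgebraicClosure (v.adicCompletion ℚ))) r
    have h0 : θ = 0 := by
      have h2 : (2 : AlgebraicClosure (v.adicCompletion ℚ)) * θ = 0 := by
        rw [two_mul]
        nth_rw 1 [← hfix]
        rw [hτθ, neg_add_cancel]
      haveI : CharZero (AlgebraicClosure (v.adicCompletion ℚ)) := charZero_of_injective_algebraMap
        (algebraMap ℚ (AlgebraicClosure (v.adicCompletion ℚ))).injective
      exact (mul_eq_zero.mp h2).resolve_left two_ne_zero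
    apply hps0
    have h := hθc
    rw [h0, zero_pow two_ne_zero, eq_comm, map_eq_zero] at h
    exact h
  -- (3) the twisted parametrisation `Ψ = T ∘ Ψ_V` of `(C • V^{(p*)})(K̄_v)`
  obtain ⟨T, hT⟩ := TwistLocalSign.exists_addEquiv_localPoints_sign V C (v.adicCompletion ℚ) hθ hθc
  have hθσ := TwistLocalSign.smul_sqrt_eq_or_eq_neg (v.adicCompletion ℚ) hθc
  let Ψ : Additive (AlgebraicClosure (v.adicCompletion ℚ))ˣ →+
      localPoints (C • V.quadraticTwist ((-1 : ℚ) ^ (p / 2) * p)) (v.adicCompletion ℚ) :=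
    T.toAddMonoidHom.comp ΨV
  have hΨ : ∀ x, Ψ x = T (ΨV x) := fun _ ↦ rfl
  have hsurj : Function.Surjective Ψ := T.surjective.comp hsurjV
  have hker : ∀ u : (AlgebraicClosure (v.adicCompletion ℚ))ˣ, Ψ (Additive.ofMul u) = 0 ↔
      ∃ n : ℤ, (u : AlgebraicClosure (v.adicCompletion ℚ)) =
        algebraMap (v.adicCompletion ℚ) (AlgebraicClosure (v.adicCompletion ℚ)) q ^ n := fun u ↦ by
    rw [hΨ, AddEquiv.map_eq_zero_iff]
    exact hkerV u
  have hsign : ∀ (σ : absoluteGaloisGroup (v.adicCompletion ℚ))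
      (u : (AlgebraicClosure (v.adicCompletion ℚ))ˣ),
      σ • Ψ (Additive.ofMul u) = Ψ (Additive.ofMul (Units.map
        (Field.absoluteGaloisGroup.toAlgEquiv (v.adicCompletion ℚ) σ :
          AlgebraicClosure (v.adicCompletion ℚ) →* AlgebraicClosure (v.adicCompletion ℚ)) u)) ∨
      σ • Ψ (Additive.ofMul u) = -Ψ (Additive.ofMul (Units.map
        (Field.absoluteGaloisGroup.toAlgEquiv (v.adicCompletion ℚ) σ :
          AlgebraicClosure (v.adicCompletion ℚ) →* AlgebraicClosure (v.adicCompletion ℚ)) u)) := by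
    intro σ u
    rw [hΨ, hΨ]
    rcases hθσ σ with hs | hs
    · rw [← (hT σ _).1 hs]
      rcases hsignV σ u with h | h
      · exact Or.inl (by rw [h])
      · exact Or.inr (by rw [h, map_neg])
    · have e : σ • T (ΨV (Additive.ofMul u)) = -T (σ • ΨV (Additive.ofMul u)) := by
        rw [(hT σ _).2 hs, neg_neg]
      rw [e]
      rcases hsignV σ u with h | h
      · exact Or.inr (by rw [h])
      · exact Or.inl (by rw [h, map_neg, neg_neg])
  have hτsign : ∀ u : (AlgebraicClosure (v.adicCompletion ℚ))ˣ,
      τ • Ψ (Additive.ofMul u) = -Ψ (Additive.ofMul (Units.map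
        (Field.absoluteGaloisGroup.toAlgEquiv (v.adicCompletion ℚ) τ :
          AlgebraicClosure (v.adicCompletion ℚ) →* AlgebraicClosure (v.adicCompletion ℚ)) u)) := by
    intro u
    rw [hΨ, hΨ]
    have e : τ • T (ΨV (Additive.ofMul u)) = -T (τ • ΨV (Additive.ofMul u)) := by
      rw [(hT τ _).2 hτθ, neg_neg]
    rw [e, hΨσ τ u, if_pos (hinert τ hτI), one_zsmul]
  -- (4) the units image `A₁ = Ψ(𝒪̄ˣ)` (F1-M)
  obtain ⟨A₁, hA₁⟩ := TateUnits.exists_unitsImage (C • V.quadraticTwist ((-1 : ℚ) ^ (p / 2) * p)) Ψ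
  obtain ⟨P₁, hP₁, hP₁ord, hK⟩ := TateUnits.exists_generator_torsion hA₁ hq0 hq1 hker p
  obtain ⟨P, hPp, hPmove⟩ :=
    TateUnits.exists_psmul_eq_zero_sub_notMem_of_sign_neg hA₁ hq0 hq1 hker p hp2 hτsign
  have hτN : τ ∈ localSubgroup κ.kerSubgroup (v.adicCompletion ℚ) := by
    rw [mem_localSubgroup_iff, resGal_eq_absGaloisRestrict]
    exact ZpExtension.mem_kerSubgroup.mpr hκτ
  -- (5) the model-free END (F2-M)
  exact StableSubgroupLine.localTowerKerPrimary_zero_eq_bot_of_stableSubgroup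
    (C • V.quadraticTwist ((-1 : ℚ) ^ (p / 2) * p)) p hpv hadd κ A₁
    (fun σ a ha ↦ TateUnits.smul_mem_of_sign hA₁ hsign σ a ha)
    (fun a ha ↦ TateUnits.exists_mem_nsmul_eq hA₁ hp.out.pos a ha)
    (TateUnits.exists_nsmul_mem hA₁ hq0 hq1 hker hsurj) hP₁ hP₁ord hK ⟨τ, hτN, P, hPp, hPmove⟩

end TateTowerKernel

/-! ## The (M) classes -/

section Classes

open TateTowerKernel

variable {W : WeierstrassCurve ℚ} [W.IsElliptic] {p : ℕ} [hp : Fact p.Prime]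
  {v : HeightOneSpectrum (𝓞 ℚ)}

/-- **pot-mult(p), odd `p`: `W.localTowerKerPrimary κ ℚ_v 0 = ⊥`** — Delbourgo 1998 §2.2 Lemma (ii)
for ADDITIVE potentially multiplicative `E/ℚ` at `p`, any `ℤ_p`-extension, modulo the PUBLISHED
Tate uniformisation A41: the `p*`-twist model (`PotMult.exists_mult_pStar_twist_model`) is
multiplicative at `p` and `E` is additive at `v` (`hasAdditiveReductionAt_of_addv`). Closes nothing
by itself (the `hp0` binder of p06's T-T3CTL ENDs on (M)-at-`p` partners).
[cite: Delbourgo1998, §2.2 Lemma (ii) (p. 139)] [cite: GreenbergLNM1716, §3 Lemma 3.4 (p. 89) and Prop. 3.8 (p. 95)]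
[cite: SilvermanATAEC1994, Ch. V Lemma 5.2 (c), Thm. 5.3, Cor. 5.4] -/
theorem PotMult.localTowerKerPrimary_zero_eq_bot
    (hT41 : Silverman1994_thmV53_corV54_tateUniformisation.{0}) (hpm : PotMult W p) (hp2 : p ≠ 2)
    (hpv : ((p : ℕ) : 𝓞 ℚ) ∈ v.asIdeal) (κ : ZpExtension ℚ p) :
    W.localTowerKerPrimary κ (v.adicCompletion ℚ) 0 = ⊥ := by
  have hadd : W.HasAdditiveReductionAt v := by
    rw [GoodModelLine.eq_primesEquiv_symm p hpv]
    exact hasAdditiveReductionAt_of_addv W p hpm.1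
  obtain ⟨V, _, _, C, hV, hC⟩ := hpm.exists_mult_pStar_twist_model hp2
  subst hC
  exact localTowerKerPrimary_zero_eq_bot_of_mult_twist hT41 hp2 V hV C hpv hadd κ

/-- **X4(M), EVERY odd `p` (`p = 3` included), ANY `ℤ_p`-extension: `W.localTowerKerPrimary κ ℚ_v 0 = ⊥`**
(mod A41) — the (M) sibling of row T-T3B's `ClassX4Gord.localTowerKerPrimary_zero_eq_bot`: after the
two rows, p06's `hp0` is a theorem on EVERY additive potentially ordinary-or-multiplicative partner at
odd `p`. X4(M) stays CONSTRUCTION-SHAPED; nothing booked.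
[cite: Delbourgo1998, §2.2 Lemma (ii) (p. 139)] [cite: GreenbergLNM1716, §3 Lemma 3.4 (p. 89) and Prop. 3.8 (p. 95)]
[cite: SilvermanATAEC1994, Ch. V Lemma 5.2 (c), Thm. 5.3, Cor. 5.4] -/
theorem ClassX4M.localTowerKerPrimary_zero_eq_bot
    (hT41 : Silverman1994_thmV53_corV54_tateUniformisation.{0}) (hX : ClassX4M W p)
    (hpv : ((p : ℕ) : 𝓞 ℚ) ∈ v.asIdeal) (κ : ZpExtension ℚ p) :
    W.localTowerKerPrimary κ (v.adicCompletion ℚ) 0 = ⊥ :=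
  (ClassX4M.potMult W p hX).localTowerKerPrimary_zero_eq_bot hT41 hX.p_ne_two hpv κ

/-- **X3♯(M), odd `p`, ANY `ℤ_p`-extension: `W.localTowerKerPrimary κ ℚ_v 0 = ⊥`** (mod A41;
reducibility of `E[p]` is irrelevant to the local statement). Nothing booked.
[cite: Delbourgo1998, §2.2 Lemma (ii) (p. 139)] [cite: GreenbergLNM1716, §3 Lemma 3.4 (p. 89) and Prop. 3.8 (p. 95)]
[cite: SilvermanATAEC1994, Ch. V Lemma 5.2 (c), Thm. 5.3, Cor. 5.4] -/
theorem ClassX3M.localTowerKerPrimary_zero_eq_bot [W.IsGloballyMinimal]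
    (hT41 : Silverman1994_thmV53_corV54_tateUniformisation.{0}) (hX : ClassX3M W p)
    (hpv : ((p : ℕ) : 𝓞 ℚ) ∈ v.asIdeal) (κ : ZpExtension ℚ p) :
    W.localTowerKerPrimary κ (v.adicCompletion ℚ) 0 = ⊥ :=
  (ClassX3M.potMult W p hX).localTowerKerPrimary_zero_eq_bot hT41 (ClassX3M.p_ne_two W p hX) hpv κ

end Classes

end Summit.BirchSwinnertonDyer.Rank1Residual.AdditivePotMult

end
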